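import Summits.AtomisticToContinuum.HydrodynamicLimit.Theorems.InformationPercolationEnginePercolationClosesChaosForecastEnumeration
import Mathlib.MeasureTheory.MeasurableSpace.Basic
import HarnessLib

/-!
# Forecast transfer S6 of the line `equilibrium-forecast-chain-rule` (crux `InformationPercolationEngine.PercolationClosesChaos`,
stmt-AtomisticToContinuum-15178) — piece F: the sequential mesoscopic filtration IS a `pastSigma`

Support file (`--supports stmt-AtomisticToContinuum-15178`) of the registered stub `stub_forecastTransfer` (worker S6 of lead
c3); the backbone shared with S5 (`stub_cesaroLocalEquilibrium`). The engine `PredictableProjection` (S1, proved) speaks of ONE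
observation sequence `Y : ℕ → Ω → S` into a countable alphabet, its past `pastSigma Y n = σ(Y_0, …, Y_n)`, increments adapted to
`pastSigma Y (n+1)` and forecasts given `pastSigma Y n`; the line's statements condition on `MeasurableSpace.comap (seqHist …) ⊤`
(`MesoConditionalEquidistribution` (a)) / `comap (seqHistEnd …) ⊤` ((b)), and increments are adapted to `comap (seqHistLE …) ⊤`.
This file builds the dictionary and proves it is EXACT (equalities of σ-algebras, for every LABEL RULE at once):

* `revealSeq b c σ N Φ L` — the observation sequence of a label rule `L : Obs N → Obs N → Cell` (the cell under which sphere `i`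
  is filed during step `k`, read off its observations at `kΔ` and `(k+1)Δ`): `Y_0 =` the initial snapshot `obs 0`, and
  `Y_{kM + j + 1} =` the step-`k` observations `obs (k+1) · i` of the spheres whose label has rank `j` (`M = #cellBox (cℓ_N)`,
  `cellRank` of piece E); `Yseq` (START-cell labels `L o o' = o.1.1`) and `YseqEnd` (END-cell labels `L o o' = o'.1.1`);
* `revealHist L k q` / `revealHistLE L k q` — the data before / right after unit `(k, q)`; `seqHist`, `seqHistEnd`, `seqHistLE`
  are these for the two label rules, by `rfl` (`seqHist_eq_revealHist`, `seqHistEnd_eq_revealHist`, `seqHistLE_eq_revealHistLE`);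
* `revealSeq_prefix_eq_iff` — the fibres of the prefix map `z ↦ (Y_0 z, …, Y_{kM+j} z)` are the agreement sets `stageAgree k j z`
  (induction over stages: `stageAgree_succ_iff` inside a step, `stageAgree_card_iff` at a step boundary), and so are the fibres
  of `revealHist L k q` (`j = cellRank h q`, `revealHist_eq_iff`) and of `revealHistLE L k q` (`j + 1`, `revealHistLE_eq_iff`);
* `pastSigma_revealSeq_eq` (registered headline), `pastSigma_revealSeq_succ_eq` — maps with the same fibres generate the same
  σ-algebra (`comap_top_eq_of_iff`): for `q ∈ cellBox h`, `pastSigma (revealSeq L) (kM + cellRank h q) = comap (revealHist L k q) ⊤`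
  and `pastSigma (revealSeq L) (kM + cellRank h q + 1) = comap (revealHistLE L k q) ⊤`;
* `measurable_comap_top_of_imp` — a function constant on the atoms of a map is measurable for its comap σ-algebra.
The specialisations to `Yseq` / `YseqEnd` and all measurability statements are the companion piece F′ (`…ForecastFiltration`).
-/

noncomputable section

open MeasureTheory Set Filter Topology
open scoped ENNReal BigOperators Classical
open Literature.Analysis.FluidPDE Literature.MathematicalPhysics.KineticTheory
open Literature.MathematicalPhysics.KineticTheory.VelocityBlindPlacement

namespace Summit.AtomisticToContinuum.HydrodynamicLimit.Theorems.EquilibriumForecastLine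

/-! ## Comaps of the discrete σ-algebra -/

/-- If `f` is (setwise) a function of `g`, then `σ(f) ≤ σ(g)` (discrete σ-algebras on the codomains). [folklore] -/
theorem comap_top_le_comap_top_of_imp {Ω A B : Type*} {f : Ω → A} {g : Ω → B} (h : ∀ z z', g z = g z' → f z = f z') :
    MeasurableSpace.comap f ⊤ ≤ MeasurableSpace.comap g ⊤ := by
  rintro s ⟨t, -, rfl⟩
  refine ⟨g '' (f ⁻¹' t), MeasurableSpace.measurableSet_top, ?_⟩
  ext z
  simp only [mem_preimage, mem_image]
  constructor
  · rintro ⟨z', hz', hzz⟩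
    rw [h z z' hzz.symm]
    exact hz'
  · intro hz
    exact ⟨z, hz, rfl⟩

/-- Maps with the same fibres generate the same σ-algebra. [folklore] -/
theorem comap_top_eq_of_iff {Ω A B : Type*} {f : Ω → A} {g : Ω → B} (h : ∀ z z', f z = f z' ↔ g z = g z') :
    MeasurableSpace.comap f ⊤ = MeasurableSpace.comap g ⊤ :=
  le_antisymm (comap_top_le_comap_top_of_imp fun z z' hg => (h z z').2 hg)
    (comap_top_le_comap_top_of_imp fun z z' hf => (h z z').1 hf)

/-- **Adaptedness by factorisation**: a function constant on the fibres of `f` is `σ(f)`-measurable. [folklore] -/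
theorem measurable_comap_top_of_imp {Ω A β : Type*} [MeasurableSpace β] {f : Ω → A} {X : Ω → β}
    (h : ∀ z z', f z = f z' → X z = X z') : Measurable[MeasurableSpace.comap f ⊤] X := by
  rw [measurable_iff_comap_le]
  exact (MeasurableSpace.comap_mono le_top).trans (comap_top_le_comap_top_of_imp h)

/-- A countably-valued map with measurable fibres generates a sub-σ-algebra of the ambient one. [folklore] -/
theorem comap_top_le_of_fibers {Ω A : Type*} [m : MeasurableSpace Ω] [Countable A] {f : Ω → A}
    (h : ∀ a, MeasurableSet {z | f z = a}) : MeasurableSpace.comap f ⊤ ≤ m := by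
  have hf : Measurable[m, ⊤] f := @measurable_to_countable' A Ω ⊤ _ m f h
  exact measurable_iff_comap_le.1 hf

/-- Below the ambient σ-algebra, every preimage is measurable. [folklore] -/
theorem measurableSet_preimage_of_comap_top_le {Ω A : Type*} [m : MeasurableSpace Ω] {f : Ω → A}
    (h : MeasurableSpace.comap f ⊤ ≤ m) (s : Set A) : MeasurableSet (f ⁻¹' s) :=
  h _ ⟨s, MeasurableSpace.measurableSet_top, rfl⟩

/-- Equality of the vectors `(Y_0 z, …, Y_n z)` is agreement of the first `n + 1` observations. [folklore] -/
theorem vec_eq_iff_prefix {Ω S : Type*} (Y : ℕ → Ω → S) (n : ℕ) (z z' : Ω) :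
    ((fun j : Fin (n + 1) => Y j z) = fun j : Fin (n + 1) => Y j z') ↔ ∀ m ≤ n, Y m z = Y m z' := by
  rw [funext_iff, Fin.forall_iff]
  simp only [Nat.lt_succ_iff]

/-- Two `Option`-valued revelations `𝟙_P · x` agree iff `x = x'` whenever one of them is revealed — provided the revelation
tests agree as soon as the data do. [folklore] -/
theorem ite_some_eq_iff {α : Type*} {P P' : Prop} [Decidable P] [Decidable P'] {x x' : α} (hdet : x = x' → (P ↔ P')) :
    ((if P then some x else none) = if P' then some x' else none) ↔ (P ∨ P' → x = x') := by
  by_cases hP : P <;> by_cases hP' : P'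
  · simp only [hP, hP', if_true, Option.some.injEq, true_or, forall_const]
  · simp only [hP, hP', if_true, if_false, reduceCtorEq, true_or, forall_const, false_iff]
    exact fun h => hP' ((hdet h).1 hP)
  · simp only [hP, hP', if_true, if_false, reduceCtorEq, or_true, forall_const, false_iff]
    exact fun h => hP ((hdet h).2 hP')
  · simp only [hP, hP', if_false, or_self, IsEmpty.forall_iff]

/-- The same for revelations `𝟙_{¬Q} · x`. [folklore] -/
theorem ite_none_eq_iff {α : Type*} {Q Q' : Prop} [Decidable Q] [Decidable Q'] {x x' : α} (hdet : x = x' → (Q ↔ Q')) :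
    ((if Q then none else some x) = if Q' then none else some x') ↔ (¬ Q ∨ ¬ Q' → x = x') := by
  by_cases hQ : Q <;> by_cases hQ' : Q'
  · simp only [hQ, hQ', if_true, not_true_eq_false, or_self, IsEmpty.forall_iff]
  · simp only [hQ, hQ', if_true, if_false, reduceCtorEq, not_true_eq_false, not_false_eq_true, or_true, forall_const,
      false_iff]
    exact fun h => hQ' ((hdet h).1 hQ)
  · simp only [hQ, hQ', if_true, if_false, reduceCtorEq, not_true_eq_false, not_false_eq_true, true_or, forall_const,
      false_iff]
    exact fun h => hQ ((hdet h).2 hQ')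
  · simp only [hQ, hQ', if_false, Option.some.injEq, not_false_eq_true, or_self, forall_const]

section ObsBox

variable {σ : ℝ} {N : ℕ} (Φ : Flow σ N) (b c : ℝ)

/-- The cell read off an observation lies in the box (`0 < h`; off the good set it is the origin). [folklore] -/
theorem obs_cell_mem_cellBox (hh : 0 < c * meanFreePath σ N) (k : ℕ) (z : Phase N) (i : Fin (N + 1)) :
    (obs b c σ N Φ k z i).1.1 ∈ cellBox (c * meanFreePath σ N) := by
  unfold obs
  split_ifs
  · exact cellOf_mem_cellBox hh _
  · exact zero_mem_cellBox hh

end ObsBox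

/-! ## The observation sequence of a label rule -/

section Reveal

variable (b c σ : ℝ) (N : ℕ) (Φ : Flow σ N) (L : Obs N → Obs N → Cell)

/-- OBSERVATION SEQUENCE of the label rule `L`: `Y_0 z = ` the initial snapshot (all of `obs 0 z`), and for the stage
`n + 1 = kM + j + 1` (`k = n / M`, `j = n % M`, `M = #cellBox (cℓ_N)`) `Y_{n+1} z i = obs (k+1) z i` if the label
`L (obs k z i) (obs (k+1) z i)` of sphere `i` during step `k` has rank `j`, and `none` otherwise. Alphabet `Fin (N+1) → Option (Obs N)`,
countable. -/
def revealSeq : ℕ → Phase N → (Fin (N + 1) → Option (Obs N))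
  | 0 => fun z i => some (obs b c σ N Φ 0 z i)
  | n + 1 => fun z i =>
      if cellRank (c * meanFreePath σ N)
          (L (obs b c σ N Φ (n / (cellBox (c * meanFreePath σ N)).card) z i)
            (obs b c σ N Φ (n / (cellBox (c * meanFreePath σ N)).card + 1) z i)) =
          n % (cellBox (c * meanFreePath σ N)).card
      then some (obs b c σ N Φ (n / (cellBox (c * meanFreePath σ N)).card + 1) z i) else none

/-- The data BEFORE unit `(k, q)` under the label rule `L`: the past `hist k` and the step-`k` observations of the spheres
labelled `<ₗₑₓ q`. -/
def revealHist (k : ℕ) (q : Cell) (z : Phase N) :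
    (Fin (k + 1) → Fin (N + 1) → Obs N) × (Fin (N + 1) → Option (Obs N)) :=
  (hist b c σ N Φ k z,
    fun i => if cellLT (L (obs b c σ N Φ k z i) (obs b c σ N Φ (k + 1) z i)) q then some (obs b c σ N Φ (k + 1) z i)
      else none)

/-- The data RIGHT AFTER unit `(k, q)` under the label rule `L`: the past `hist k` and the step-`k` observations of the
spheres labelled `≤ₗₑₓ q`. -/
def revealHistLE (k : ℕ) (q : Cell) (z : Phase N) :
    (Fin (k + 1) → Fin (N + 1) → Obs N) × (Fin (N + 1) → Option (Obs N)) :=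
  (hist b c σ N Φ k z,
    fun i => if cellLT q (L (obs b c σ N Φ k z i) (obs b c σ N Φ (k + 1) z i)) then none
      else some (obs b c σ N Φ (k + 1) z i))

/-- AGREEMENT SET of the datum `z` up to in-step index `j` of step `k`: the data `z'` whose first `k + 1` snapshots agree
with those of `z`, and whose step-`k` observation of every sphere with label of rank `< j` (for either datum) agrees too
(the atom of `z` for the prefix map of `revealSeq`, `revealSeq_prefix_eq_iff`). -/
def stageAgree (k j : ℕ) (z : Phase N) : Set (Phase N) :=
  {z' | (∀ k' ≤ k, obs b c σ N Φ k' z = obs b c σ N Φ k' z') ∧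
    ∀ i, (cellRank (c * meanFreePath σ N) (L (obs b c σ N Φ k z i) (obs b c σ N Φ (k + 1) z i)) < j ∨
        cellRank (c * meanFreePath σ N) (L (obs b c σ N Φ k z' i) (obs b c σ N Φ (k + 1) z' i)) < j) →
      obs b c σ N Φ (k + 1) z i = obs b c σ N Φ (k + 1) z' i}

/-- The START-CELL observation sequence of the line (spheres filed by their cell at `kΔ`): its past at stage `kM + cellRank h q`
is `σ(seqHist k q)` (`pastSigma_Yseq_eq_seqHist`). -/
def Yseq : ℕ → Phase N → (Fin (N + 1) → Option (Obs N)) := revealSeq b c σ N Φ fun o _ => o.1.1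

/-- The END-CELL observation sequence of the line (spheres filed by their cell at `(k+1)Δ`): its past at stage `kM + cellRank h q`
is `σ(seqHistEnd k q)` (`pastSigma_YseqEnd_eq_seqHistEnd`). -/
def YseqEnd : ℕ → Phase N → (Fin (N + 1) → Option (Obs N)) := revealSeq b c σ N Φ fun _ o' => o'.1.1

/-- `seqHist` is the start-cell `revealHist`. [folklore] -/
theorem seqHist_eq_revealHist (k : ℕ) (q : Cell) :
    seqHist b c σ N Φ k q = revealHist b c σ N Φ (fun o _ => o.1.1) k q := rfl

/-- `seqHistLE` is the start-cell `revealHistLE`. [folklore] -/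
theorem seqHistLE_eq_revealHistLE (k : ℕ) (q : Cell) :
    seqHistLE b c σ N Φ k q = revealHistLE b c σ N Φ (fun o _ => o.1.1) k q := rfl

/-- `seqHistEnd` is the end-cell `revealHist`. [folklore] -/
theorem seqHistEnd_eq_revealHist (k : ℕ) (q : Cell) :
    seqHistEnd b c σ N Φ k q = revealHist b c σ N Φ (fun _ o' => o'.1.1) k q := rfl

end Reveal

/-! ## The fibres of the prefix maps: induction over stages -/

section Fibres

variable {σ : ℝ} {N : ℕ} (Φ : Flow σ N) (b c : ℝ) (L : Obs N → Obs N → Cell)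

/-- Stage `0`: the initial snapshots agree. [folklore] -/
theorem revealSeq_zero_eq_iff (z z' : Phase N) :
    revealSeq b c σ N Φ L 0 z = revealSeq b c σ N Φ L 0 z' ↔ z' ∈ stageAgree b c σ N Φ L 0 0 z := by
  simp only [stageAgree, mem_setOf_eq]
  simp only [Nat.le_zero, forall_eq, Nat.not_lt_zero, or_self, IsEmpty.forall_iff, implies_true, and_true]
  show ((fun i => some (obs b c σ N Φ 0 z i)) = fun i => some (obs b c σ N Φ 0 z' i)) ↔ _
  simp only [funext_iff, Option.some.injEq]

/-- The revelation at stage `kM + j + 1` (`j < M`), unfolded. [folklore] -/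
theorem revealSeq_stage_succ {k j : ℕ} (hj : j < (cellBox (c * meanFreePath σ N)).card) (z : Phase N) (i : Fin (N + 1)) :
    revealSeq b c σ N Φ L (k * (cellBox (c * meanFreePath σ N)).card + j + 1) z i =
      if cellRank (c * meanFreePath σ N) (L (obs b c σ N Φ k z i) (obs b c σ N Φ (k + 1) z i)) = j
      then some (obs b c σ N Φ (k + 1) z i) else none := by
  have hM : 0 < (cellBox (c * meanFreePath σ N)).card := lt_of_le_of_lt (Nat.zero_le j) hj
  have hdiv : (k * (cellBox (c * meanFreePath σ N)).card + j) / (cellBox (c * meanFreePath σ N)).card = k := by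
    rw [Nat.add_comm, Nat.add_mul_div_right _ _ hM, Nat.div_eq_of_lt hj, Nat.zero_add]
  have hmod : (k * (cellBox (c * meanFreePath σ N)).card + j) % (cellBox (c * meanFreePath σ N)).card = j := by
    rw [Nat.add_comm, Nat.add_mul_mod_self_right, Nat.mod_eq_of_lt hj]
  show (if cellRank (c * meanFreePath σ N) (L (obs b c σ N Φ ((k * (cellBox (c * meanFreePath σ N)).card + j) /
      (cellBox (c * meanFreePath σ N)).card) z i) (obs b c σ N Φ ((k * (cellBox (c * meanFreePath σ N)).card + j) /
      (cellBox (c * meanFreePath σ N)).card + 1) z i)) = (k * (cellBox (c * meanFreePath σ N)).card + j) %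
      (cellBox (c * meanFreePath σ N)).card then some (obs b c σ N Φ ((k * (cellBox (c * meanFreePath σ N)).card + j) /
      (cellBox (c * meanFreePath σ N)).card + 1) z i) else none) = _
  rw [hdiv, hmod]

/-- One more unit inside a step: agreement up to `j + 1` is agreement up to `j` plus agreement of the revelation at stage
`kM + j + 1`. [folklore] -/
theorem stageAgree_succ_iff {k j : ℕ} (hj : j < (cellBox (c * meanFreePath σ N)).card) (z z' : Phase N) :
    z' ∈ stageAgree b c σ N Φ L k (j + 1) z ↔
      z' ∈ stageAgree b c σ N Φ L k j z ∧
        revealSeq b c σ N Φ L (k * (cellBox (c * meanFreePath σ N)).card + j + 1) z =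
          revealSeq b c σ N Φ L (k * (cellBox (c * meanFreePath σ N)).card + j + 1) z' := by
  have hY : ∀ (hk : obs b c σ N Φ k z = obs b c σ N Φ k z') (i : Fin (N + 1)),
      revealSeq b c σ N Φ L (k * (cellBox (c * meanFreePath σ N)).card + j + 1) z i =
          revealSeq b c σ N Φ L (k * (cellBox (c * meanFreePath σ N)).card + j + 1) z' i ↔
        (cellRank (c * meanFreePath σ N) (L (obs b c σ N Φ k z i) (obs b c σ N Φ (k + 1) z i)) = j ∨
            cellRank (c * meanFreePath σ N) (L (obs b c σ N Φ k z' i) (obs b c σ N Φ (k + 1) z' i)) = j) →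
          obs b c σ N Φ (k + 1) z i = obs b c σ N Φ (k + 1) z' i := by
    intro hk i
    rw [revealSeq_stage_succ Φ b c L hj, revealSeq_stage_succ Φ b c L hj]
    refine ite_some_eq_iff fun h => ?_
    rw [h, show obs b c σ N Φ k z i = obs b c σ N Φ k z' i from congrFun hk i]
  simp only [stageAgree, mem_setOf_eq]
  constructor
  · rintro ⟨hA, hE⟩
    refine ⟨⟨hA, fun i hi => hE i (by omega)⟩, funext fun i => (hY (hA k le_rfl) i).2 fun hi => hE i (by omega)⟩
  · rintro ⟨⟨hA, hE⟩, hYeq⟩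
    refine ⟨hA, fun i hi => ?_⟩
    have h1 := (hY (hA k le_rfl) i).1 (congrFun hYeq i)
    by_cases hij : cellRank (c * meanFreePath σ N) (L (obs b c σ N Φ k z i) (obs b c σ N Φ (k + 1) z i)) = j ∨
        cellRank (c * meanFreePath σ N) (L (obs b c σ N Φ k z' i) (obs b c σ N Φ (k + 1) z' i)) = j
    · exact h1 hij
    · exact hE i (by omega)

/-- The step boundary: agreement up to the last unit of step `k` is agreement of the first `k + 2` snapshots, i.e. agreement
up to (before) the first unit of step `k + 1` (labels lie in the box). [folklore] -/
theorem stageAgree_card_iff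
    (hbox : ∀ k z i, L (obs b c σ N Φ k z i) (obs b c σ N Φ (k + 1) z i) ∈ cellBox (c * meanFreePath σ N))
    (k : ℕ) (z z' : Phase N) :
    z' ∈ stageAgree b c σ N Φ L k (cellBox (c * meanFreePath σ N)).card z ↔ z' ∈ stageAgree b c σ N Φ L (k + 1) 0 z := by
  simp only [stageAgree, mem_setOf_eq]
  simp only [Nat.not_lt_zero, or_self, IsEmpty.forall_iff, implies_true, and_true]
  constructor
  · rintro ⟨hA, hE⟩ k' hk'
    rcases Nat.lt_or_ge k' (k + 1) with hlt | hge
    · exact hA k' (Nat.lt_succ_iff.1 hlt)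
    · have hk : k' = k + 1 := le_antisymm hk' hge
      subst hk
      exact funext fun i => hE i (Or.inl (cellRank_lt_card (hbox k z i)))
  · intro hA
    exact ⟨fun k' hk' => hA k' (Nat.le_succ_of_le hk'), fun i _ => congrFun (hA (k + 1) le_rfl) i⟩

/-- **The fibres of the prefix maps.** For `j ≤ M` the first `kM + j + 1` revelations of two data agree iff the data agree up
to in-step index `j` of step `k` (`stageAgree`). Induction over stages. [folklore] -/
theorem revealSeq_prefix_eq_iff
    (hbox : ∀ k z i, L (obs b c σ N Φ k z i) (obs b c σ N Φ (k + 1) z i) ∈ cellBox (c * meanFreePath σ N))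
    (hM : 0 < (cellBox (c * meanFreePath σ N)).card) (z z' : Phase N) :
    ∀ (n k j : ℕ), j ≤ (cellBox (c * meanFreePath σ N)).card → n = k * (cellBox (c * meanFreePath σ N)).card + j →
      ((∀ m ≤ n, revealSeq b c σ N Φ L m z = revealSeq b c σ N Φ L m z') ↔ z' ∈ stageAgree b c σ N Φ L k j z) := by
  set M := (cellBox (c * meanFreePath σ N)).card with hMdef
  intro n
  induction n with
  | zero =>
    intro k j _ hn
    have hj0 : j = 0 := by omega
    have hk0 : k = 0 := by
      rcases Nat.eq_zero_or_pos k with hk | hk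
      · exact hk
      · exfalso
        have : M ≤ k * M := Nat.le_mul_of_pos_left M hk
        omega
    subst hj0 hk0
    simp only [Nat.le_zero, forall_eq]
    exact revealSeq_zero_eq_iff Φ b c L z z'
  | succ n ih =>
    -- the case of a positive in-step index
    have key : ∀ k₁ j₁ : ℕ, 1 ≤ j₁ → j₁ ≤ M → n + 1 = k₁ * M + j₁ →
        ((∀ m ≤ n + 1, revealSeq b c σ N Φ L m z = revealSeq b c σ N Φ L m z') ↔
          z' ∈ stageAgree b c σ N Φ L k₁ j₁ z) := by
      intro k₁ j₁ hj1 hjM hn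
      obtain ⟨j₀, rfl⟩ : ∃ j₀, j₁ = j₀ + 1 := ⟨j₁ - 1, by omega⟩
      have hn0 : n = k₁ * M + j₀ := by omega
      have hj0 : j₀ < M := by omega
      rw [stageAgree_succ_iff Φ b c L hj0, ← ih k₁ j₀ hj0.le hn0, ← hn0]
      constructor
      · intro h
        exact ⟨fun m hm => h m (Nat.le_succ_of_le hm), h (n + 1) le_rfl⟩
      · rintro ⟨h, hlast⟩ m hm
        rcases Nat.lt_or_ge m (n + 1) with hlt | hge
        · exact h m (Nat.lt_succ_iff.1 hlt)
        · rw [le_antisymm hm hge]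
          exact hlast
    intro k j hjM hn
    rcases Nat.eq_zero_or_pos j with hj | hj
    · subst hj
      obtain ⟨k₀, rfl⟩ : ∃ k₀, k = k₀ + 1 := by
        rcases Nat.eq_zero_or_pos k with hk | hk
        · subst hk; omega
        · exact ⟨k - 1, by omega⟩
      rw [← stageAgree_card_iff Φ b c L hbox k₀ z z']
      exact key k₀ M hM le_rfl (by rw [hn]; ring)
    · exact key k j hj hjM hn

/-- **The fibres of `revealHist`**: for `q` in the box, two data have the same data before unit `(k, q)` iff they agree up to
in-step index `cellRank h q` of step `k`. [folklore] -/
theorem revealHist_eq_iff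
    (hbox : ∀ k z i, L (obs b c σ N Φ k z i) (obs b c σ N Φ (k + 1) z i) ∈ cellBox (c * meanFreePath σ N))
    {q : Cell} (hq : q ∈ cellBox (c * meanFreePath σ N)) (k : ℕ) (z z' : Phase N) :
    revealHist b c σ N Φ L k q z = revealHist b c σ N Φ L k q z' ↔
      z' ∈ stageAgree b c σ N Φ L k (cellRank (c * meanFreePath σ N) q) z := by
  simp only [revealHist, stageAgree, mem_setOf_eq, Prod.mk.injEq]
  have hhist : hist b c σ N Φ k z = hist b c σ N Φ k z' ↔ ∀ k' ≤ k, obs b c σ N Φ k' z = obs b c σ N Φ k' z' := by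
    unfold hist
    rw [funext_iff, Fin.forall_iff]
    simp only [Nat.lt_succ_iff]
  rw [hhist]
  refine and_congr_right fun hA => ?_
  rw [funext_iff]
  refine forall_congr' fun i => ?_
  rw [← cellLT_iff_cellRank_lt (hbox k z i) hq, ← cellLT_iff_cellRank_lt (hbox k z' i) hq]
  refine ite_some_eq_iff fun h => ?_
  rw [h, show obs b c σ N Φ k z i = obs b c σ N Φ k z' i from congrFun (hA k le_rfl) i]

/-- **The fibres of `revealHistLE`**: for `q` in the box, two data have the same data right after unit `(k, q)` iff they agree
up to in-step index `cellRank h q + 1` of step `k`. [folklore] -/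
theorem revealHistLE_eq_iff
    (hbox : ∀ k z i, L (obs b c σ N Φ k z i) (obs b c σ N Φ (k + 1) z i) ∈ cellBox (c * meanFreePath σ N))
    {q : Cell} (hq : q ∈ cellBox (c * meanFreePath σ N)) (k : ℕ) (z z' : Phase N) :
    revealHistLE b c σ N Φ L k q z = revealHistLE b c σ N Φ L k q z' ↔
      z' ∈ stageAgree b c σ N Φ L k (cellRank (c * meanFreePath σ N) q + 1) z := by
  simp only [revealHistLE, stageAgree, mem_setOf_eq, Prod.mk.injEq]
  have hhist : hist b c σ N Φ k z = hist b c σ N Φ k z' ↔ ∀ k' ≤ k, obs b c σ N Φ k' z = obs b c σ N Φ k' z' := by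
    unfold hist
    rw [funext_iff, Fin.forall_iff]
    simp only [Nat.lt_succ_iff]
  rw [hhist]
  refine and_congr_right fun hA => ?_
  rw [funext_iff]
  refine forall_congr' fun i => ?_
  simp only [Nat.lt_succ_iff]
  rw [← not_cellLT_iff_cellRank_le (hbox k z i) hq, ← not_cellLT_iff_cellRank_le (hbox k z' i) hq]
  refine ite_none_eq_iff fun h => ?_
  rw [h, show obs b c σ N Φ k z i = obs b c σ N Φ k z' i from congrFun (hA k le_rfl) i]

end Fibres

/-! ## The σ-algebra identities -/

/-- **Registered helper `pastSigma_revealSeq_eq` (piece F of S5/S6, the filtration backbone): the past of the observation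
sequence of a label rule before unit `(k, q)` — stage `k · #cellBox (cℓ_N) + cellRank (cℓ_N) q` — IS `σ(revealHist L k q)`**
(labels in the box, `q` in the box); specialised to the start-cell rule this is `pastSigma (Yseq …) n = comap (seqHist … k q) ⊤`
(`pastSigma_Yseq_eq_seqHist`, piece F′), to the end-cell rule `… = comap (seqHistEnd … k q) ⊤`. [folklore] -/
theorem pastSigma_revealSeq_eq : ∀ {σ : ℝ} {N : ℕ} (Φ : Flow σ N) (b c : ℝ) (L : Obs N → Obs N → Cell), (∀ (k : ℕ) (z : Phase N) (i : Fin (N + 1)), L (obs b c σ N Φ k z i) (obs b c σ N Φ (k + 1) z i) ∈ cellBox (c * meanFreePath σ N)) → ∀ {q : Cell}, q ∈ cellBox (c * meanFreePath σ N) → ∀ (k : ℕ), pastSigma (revealSeq b c σ N Φ L) (k * (cellBox (c * meanFreePath σ N)).card + cellRank (c * meanFreePath σ N) q) = MeasurableSpace.comap (revealHist b c σ N Φ L k q) ⊤ := by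
  intro σ N Φ b c L hbox q hq k
  have hM : 0 < (cellBox (c * meanFreePath σ N)).card := Finset.card_pos.2 ⟨q, hq⟩
  refine comap_top_eq_of_iff fun z z' => ?_
  rw [vec_eq_iff_prefix, revealSeq_prefix_eq_iff Φ b c L hbox hM z z' _ k _ (cellRank_lt_card hq).le rfl,
    revealHist_eq_iff Φ b c L hbox hq]

section Succ

variable {σ : ℝ} {N : ℕ} (Φ : Flow σ N) (b c : ℝ) (L : Obs N → Obs N → Cell)

/-- **The past of the observation sequence right after unit `(k, q)` IS `σ(revealHistLE L k q)`** (`q` in the box). [folklore] -/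
theorem pastSigma_revealSeq_succ_eq
    (hbox : ∀ k z i, L (obs b c σ N Φ k z i) (obs b c σ N Φ (k + 1) z i) ∈ cellBox (c * meanFreePath σ N))
    {q : Cell} (hq : q ∈ cellBox (c * meanFreePath σ N)) (k : ℕ) :
    pastSigma (revealSeq b c σ N Φ L)
        (k * (cellBox (c * meanFreePath σ N)).card + cellRank (c * meanFreePath σ N) q + 1) =
      MeasurableSpace.comap (revealHistLE b c σ N Φ L k q) ⊤ := by
  have hM : 0 < (cellBox (c * meanFreePath σ N)).card := Finset.card_pos.2 ⟨q, hq⟩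
  refine comap_top_eq_of_iff fun z z' => ?_
  rw [vec_eq_iff_prefix, revealSeq_prefix_eq_iff Φ b c L hbox hM z z' _ k (cellRank (c * meanFreePath σ N) q + 1)
    (cellRank_lt_card hq) (by ring), revealHistLE_eq_iff Φ b c L hbox hq]

end Succ

end Summit.AtomisticToContinuum.HydrodynamicLimit.Theorems.EquilibriumForecastLine

end
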